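import Literature.NumberTheory.EllipticCurves.LocalKernelOfReductionNodePTorsionProofs
import Literature.NumberTheory.EllipticCurves.PointDivisibilityProofs
import Literature.NumberTheory.EllipticCurves.ZpExtensionEisensteinOrdinaryFilTransferProofs
import HarnessLib

/-!
# `p`-divisibility of the kernel of reduction `E₁(K̄_v)` at a MULTIPLICATIVE place, reduced to the LEVEL-ONE component-group clause
# «`(E(K̄_v)/E₀(K̄_v))[p]` is generated by any non-trivial element» (theorems only; no definition, no named fact, no instance, no `sorry`)

Topic `NumberTheory/EllipticCurves` (LEAD `bsd-wall-utd-p1`, crux r205 stmt-BirchSwinnertonDyer-24737 `…UniversalToricDescent.TwinAlgMuZeroAtThree`,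
line `beta-road`, stub `stub_howardOutputsOfFamily`, E2 unit at `v ∣ 3`).  After `TorsionFilAtCyclicOfOrdinaryPointProofs`,
`TorsionFilAtCyclicMultiplicativeThreeProofs`, `ZpExtensionEisensteinOrdinaryCoreIsotropyOfOrdinaryPointProofs` and
`LocalKernelOfReductionNodePTorsionProofs`, the one input of cell x9's H.4 / H.5(b) assemblies at `v ∣ p` still tied to GOOD reduction is
the `p`-divisibility of `E₁(K̄_v)` (`exists_nsmul_eq_of_mem_localKernelOfReduction`, whence `exists_mem_torsionFilAt_reduce_eq` —
the surjectivity `×p : Fil_v E[p^{k+1}] → Fil_v E[p^k]` consumed by `eisensteinTwistTransfer_mem_twistedFil_ordinaryFiltrationAt`).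
x9's proof («divide in `E(K̄_v)`, then correct by a `p`-torsion point with the same reduction», Greenberg LNM 1716 §2 p. 82) runs at a
multiplicative place as soon as

  (†) every `R ∈ E(K̄_v)` with `p • R ∈ E₁(K̄_v)` is congruent modulo `E₁(K̄_v)` to a `p`-torsion point,

and by `0 → E₀/E₁ → E/E₁ → E/E₀ → 0` (AEC VII.2.1) with `(E₀/E₁)[p] = 0` (`LocalKernelOfReductionNodePTorsionProofs`) and a `p`-torsion point
OUTSIDE `E₀` (at `p = 3`: `TorsionFilAtCyclicMultiplicativeThreeProofs`), (†) follows from the LEVEL-ONE COMPONENT-GROUP CLAUSE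

  (‡) for `R₁, R₂ ∈ E(K̄_v)` with `p • R₁, p • R₂ ∈ E₀(K̄_v)` and `R₁ ∉ E₀(K̄_v)`: `R₂ − j • R₁ ∈ E₀(K̄_v)` for some `j`

(«`(E/E₀)[p]` has order `≤ p`», Kodaira–Néron for type `I_n`: Tate's algorithm §7 case I_n; ATAEC IV.9.4; for the Tate curve `E/E₀ ⊗ ℚ_p/ℤ_p`-like
with `p`-torsion of order `p`).  This file proves these reductions (valuation-ring currency, then number-field currency), so that (‡) at a
multiplicative `v ∣ 3` is the ONLY local input of the twin's E2 unit not yet in the kernel: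

* `exists_nsmul_eq_reducesToZero_of_cover` — (†) ⟹ `E₁` is `p`-divisible;
* `cover_of_componentClause` — nodal reduction + (‡) + a `p`-torsion point outside `E₀` ⟹ (†);
* `exists_nsmul_eq_of_mem_localKernelOfReduction_of_componentClause_three` — at a multiplicative `v ∋ 3` of a number field: (‡) ⟹
  `E₁(K̄_v)` is `3`-divisible;
* **`exists_mem_torsionFilAt_reduce_eq_of_componentClause_three`** — (‡) ⟹ `×3 : Fil_v E[3^{k+1}] → Fil_v E[3^k]` onto (the binder shape
  `hFsurj` of x9's `eisensteinTwistTransfer_mem_twistedFil`).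

References: R. Greenberg, LNM 1716 (1999), §2 p. 82 [GreenbergLNM1716]; J. H. Silverman, AEC (2009), VII.2.1, III.2.5, VIII.2
[SilvermanAEC2009]; J. Tate, LNM 476 (1975), §7 case I_n [Tate1975Algorithm]; J. H. Silverman, ATAEC (1994), IV.9.4, V.3 [SilvermanATAEC1994].
BSD is not proved by any of this.
-/

noncomputable section

open scoped NNReal Classical ContRepresentation
open NumberField IsDedekindDomain Field

namespace WeierstrassCurve

open Literature.NumberTheory.EllipticCurves Literature.NumberTheory.GaloisRepresentations
  IsDedekindDomain.HeightOneSpectrum AddSubgroup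

universe u v

/-! ## §1 Valuation-ring currency -/

section ValuationRing

variable {L : Type u} [Field L] [IsAlgClosed L] (O : ValuationSubring L)
  {Γ₀ : Type v} [LinearOrderedCommGroupWithZero Γ₀] {ν : Valuation L Γ₀} (hν : ν.Integers O)
  {M : WeierstrassCurve O} {p : ℕ} [hp : Fact p.Prime]

/-- **(†) ⟹ `E₁` is `p`-divisible** («divide in `E(L)`, `L` algebraically closed, then correct by a `p`-torsion point congruent modulo `E₁`»).
[cite: GreenbergLNM1716, §2 p. 82 («since 𝓕(𝔪̄) is divisible»)] [cite: SilvermanAEC2009, §VIII.2 (0 → E[m] → E(K̄) → E(K̄) → 0)] -/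
theorem exists_nsmul_eq_reducesToZero_of_cover [(M.baseChange L).IsElliptic]
    (hcover : ∀ R : (M.baseChange L).toAffine.Point, ReducesToZero M (p • R) →
      ∃ t : (M.baseChange L).toAffine.Point, p • t = 0 ∧ ReducesToZero M (R - t))
    {Q : (M.baseChange L).toAffine.Point} (hQ : ReducesToZero M Q) :
    ∃ R : (M.baseChange L).toAffine.Point, ReducesToZero M R ∧ p • R = Q := by
  obtain ⟨R₀, hR₀⟩ := (M.baseChange L).nsmul_surjective_of_isAlgClosed hp.out.ne_zero Q
  have hR₀ : p • R₀ = Q := hR₀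
  obtain ⟨t, hpt, ht⟩ := hcover R₀ (by rw [hR₀]; exact hQ)
  exact ⟨R₀ - t, ht, by rw [smul_sub, hR₀, hpt, sub_zero]⟩

include hν in
/-- **(‡) ⟹ (†) for a nodal reduction.**  If the reduction of `M` is nodal (`Δ(M̃) = 0 ≠ c₄(M̃)`, residue characteristic `p`), some `p`-torsion
point `t₀` lies OUTSIDE `E₀` (points with nonsingular reduction), and the component clause (‡) holds, then every `R` with `p • R ∈ E₁`
is congruent modulo `E₁` to a `p`-torsion point: if `R ∈ E₀` use `(E₀/E₁)[p] = 0`; otherwise `R − j • t₀ ∈ E₀` by (‡), and again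
`(E₀/E₁)[p] = 0`. [cite: SilvermanAEC2009, Prop. VII.2.1 and Prop. III.2.5] [cite: Tate1975Algorithm, §7 case I_n] -/
theorem cover_of_componentClause [CharP (IsLocalRing.ResidueField O) p]
    (hΔ : (M.map (IsLocalRing.residue O)).Δ = 0) (hc₄ : (M.map (IsLocalRing.residue O)).c₄ ≠ 0)
    (hord : ∃ t₀ : (M.baseChange L).toAffine.Point, p • t₀ = 0 ∧ ¬ HasNonsingularReduction M t₀)
    (hcomp : ∀ R₁ R₂ : (M.baseChange L).toAffine.Point, HasNonsingularReduction M (p • R₁) →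
      HasNonsingularReduction M (p • R₂) → ¬ HasNonsingularReduction M R₁ →
        ∃ j : ℕ, HasNonsingularReduction M (R₂ - j • R₁)) :
    ∀ R : (M.baseChange L).toAffine.Point, ReducesToZero M (p • R) →
      ∃ t : (M.baseChange L).toAffine.Point, p • t = 0 ∧ ReducesToZero M (R - t) := by
  intro R hpR
  by_cases hR : HasNonsingularReduction M R
  · refine ⟨0, smul_zero _, ?_⟩
    rw [sub_zero]
    exact reducesToZero_of_reducesToZero_nsmul_of_node O hν hΔ hc₄ hR hpR
  · obtain ⟨t₀, hpt₀, ht₀⟩ := hord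
    obtain ⟨j, hj⟩ := hcomp t₀ R (by rw [hpt₀]; exact hasNonsingularReduction_zero) hpR.hasNonsingularReduction ht₀
    refine ⟨j • t₀, by rw [smul_comm, hpt₀, smul_zero], ?_⟩
    apply reducesToZero_of_reducesToZero_nsmul_of_node O hν hΔ hc₄ hj
    rw [smul_sub, smul_comm, hpt₀, smul_zero, sub_zero]
    exact hpR

end ValuationRing

/-! ## §2 Number-field currency: a place `v ∋ 3` of multiplicative reduction -/

section NumberField

variable {K : Type u} [Field K] [NumberField K] (W : WeierstrassCurve K) [W.IsElliptic]
  (v : HeightOneSpectrum (𝓞 K))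

/-- **`E₁(K̄_v)` is `3`-divisible at a multiplicative `v ∋ 3`, GIVEN the level-one component clause (‡)** on the spectral model
(`R₂ − j • R₁ ∈ E₀` for `3R₁, 3R₂ ∈ E₀`, `R₁ ∉ E₀`): the nodal reduction, the `3`-torsion point outside `E₁` (hence outside `E₀`) of
`TorsionFilAtCyclicMultiplicativeThreeProofs` and `(E₀/E₁)[3] = 0` do the rest.
[cite: GreenbergLNM1716, §2 p. 82] [cite: Tate1975Algorithm, §7 case I_n] [cite: SilvermanAEC2009, Prop. VII.2.1] -/
theorem exists_nsmul_eq_of_mem_localKernelOfReduction_of_componentClause_three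
    (h3v : ((3 : ℕ) : 𝓞 K) ∈ v.asIdeal) (hmult : W.HasMultiplicativeReductionAt v)
    (hcomp : ∀ R₁ R₂ : localPoints W (v.adicCompletion K),
      HasNonsingularReduction (W.localSpectralModel v) (W.localPointsEquivSpectralModel v ((3 : ℕ) • R₁)) →
      HasNonsingularReduction (W.localSpectralModel v) (W.localPointsEquivSpectralModel v ((3 : ℕ) • R₂)) →
      ¬ HasNonsingularReduction (W.localSpectralModel v) (W.localPointsEquivSpectralModel v R₁) →
        ∃ j : ℕ, HasNonsingularReduction (W.localSpectralModel v) (W.localPointsEquivSpectralModel v (R₂ - j • R₁)))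
    {a : localPoints W (v.adicCompletion K)} (ha : a ∈ W.localKernelOfReduction v) :
    ∃ b : localPoints W (v.adicCompletion K), b ∈ W.localKernelOfReduction v ∧ (3 : ℕ) • b = a := by
  haveI : Fact (Nat.Prime 3) := ⟨Nat.prime_three⟩
  let O : ValuationSubring (AlgebraicClosure (v.adicCompletion K)) := (v.spectralValuation).valuationSubring
  have hvO : (v.spectralValuation).Integers O := Valuation.valuationSubring.integers _
  haveI hkv : CharP (IsLocalRing.ResidueField (v.adicCompletionIntegers K)) 3 :=
    ringChar.of_eq (ringChar_residueField_eq v Nat.prime_three h3v)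
  haveI : CharP (IsLocalRing.ResidueField O) 3 := (RingHom.charP_iff_charP (v.residueFieldToSpectral) 3).mp hkv
  obtain ⟨hΔ, hc₄⟩ := W.reductionAt_Δ_eq_zero_and_c₄_ne_zero_of_hasMultiplicativeReductionAt v hmult
  have hΔ' : ((show WeierstrassCurve O from W.localSpectralModel v).map (IsLocalRing.residue O)).Δ = 0 := by
    have h : ((W.localSpectralModel v).map (IsLocalRing.residue _)).Δ = 0 := by
      rw [localSpectralModel_map_residue, map_Δ]
      change v.residueFieldToSpectral (W.reductionAt v).Δ = 0
      rw [hΔ, map_zero]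
    exact h
  have hc₄' : ((show WeierstrassCurve O from W.localSpectralModel v).map (IsLocalRing.residue O)).c₄ ≠ 0 := by
    have h : ((W.localSpectralModel v).map (IsLocalRing.residue _)).c₄ ≠ 0 := by
      rw [localSpectralModel_map_residue, map_c₄]
      change v.residueFieldToSpectral (W.reductionAt v).c₄ ≠ 0
      exact (map_ne_zero_iff _ (RingHom.injective _)).mpr hc₄
    exact h
  -- the generic fibre of the spectral model is elliptic
  have hΔL : ((show WeierstrassCurve O from W.localSpectralModel v).baseChange
      (AlgebraicClosure (v.adicCompletion K))).Δ ≠ 0 := by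
    have h1 : ((W.localSpectralModel v).baseChange (AlgebraicClosure (v.adicCompletion K))).Δ ≠ 0 := by
      rw [localSpectralModel_baseChange, ← smul_baseChange_eq_map_localMinimalIntegralModel]
      haveI := W.isElliptic_localMinimalModel v
      change ((W.localMinimalModel v).baseChange (AlgebraicClosure (v.adicCompletion K))).Δ ≠ 0
      exact (WeierstrassCurve.isUnit_Δ _).ne_zero
    exact h1
  haveI : ((show WeierstrassCurve O from W.localSpectralModel v).baseChange
      (AlgebraicClosure (v.adicCompletion K))).IsElliptic := ⟨isUnit_iff_ne_zero.mpr hΔL⟩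
  set T := W.localPointsEquivSpectralModel v with hT
  -- a `3`-torsion point outside `E₁`, hence outside `E₀`
  obtain ⟨P, h3P, hP⟩ := W.exists_ordinaryPoint_local_of_hasMultiplicativeReductionAt_three v h3v hmult
  have h3TP : (3 : ℕ) • T P = 0 := by
    have e1 : (3 : ℕ) • T P = T (((3 : ℕ) : ℤ) • P) := by rw [map_zsmul, natCast_zsmul]
    rw [e1, h3P, map_zero]
  have hP₀ : ¬ HasNonsingularReduction (W.localSpectralModel v) (T P) := by
    intro hns
    apply hP
    have h3P' : ReducesToZero (W.localSpectralModel v) ((3 : ℕ) • T P) := by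
      rw [h3TP]
      exact reducesToZero_zero
    exact (W.mem_localKernelOfReduction_iff v P).mpr
      (reducesToZero_of_reducesToZero_nsmul_of_node O hvO (M := show WeierstrassCurve O from W.localSpectralModel v)
        hΔ' hc₄' hns h3P')
  have hord : ∃ t₀ : ((W.localSpectralModel v).baseChange (AlgebraicClosure (v.adicCompletion K))).toAffine.Point,
      (3 : ℕ) • t₀ = 0 ∧ ¬ HasNonsingularReduction (W.localSpectralModel v) t₀ :=
    ⟨T P, h3TP, hP₀⟩
  -- (‡) transported along `T`
  have hcomp' : ∀ R₁ R₂ : ((W.localSpectralModel v).baseChange (AlgebraicClosure (v.adicCompletion K))).toAffine.Point,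
      HasNonsingularReduction (W.localSpectralModel v) ((3 : ℕ) • R₁) →
      HasNonsingularReduction (W.localSpectralModel v) ((3 : ℕ) • R₂) →
      ¬ HasNonsingularReduction (W.localSpectralModel v) R₁ →
        ∃ j : ℕ, HasNonsingularReduction (W.localSpectralModel v) (R₂ - j • R₁) := by
    intro R₁ R₂ h₁ h₂ hn
    obtain ⟨j, hj⟩ := hcomp (T.symm R₁) (T.symm R₂)
      (by rw [map_nsmul, AddEquiv.apply_symm_apply]; exact h₁)
      (by rw [map_nsmul, AddEquiv.apply_symm_apply]; exact h₂)
      (by rw [AddEquiv.apply_symm_apply]; exact hn)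
    refine ⟨j, ?_⟩
    rw [map_sub, map_nsmul, AddEquiv.apply_symm_apply, AddEquiv.apply_symm_apply] at hj
    exact hj
  have hcover := cover_of_componentClause O hvO (M := show WeierstrassCurve O from W.localSpectralModel v) (p := 3)
    hΔ' hc₄' hord hcomp'
  obtain ⟨R, hR, h3R⟩ := exists_nsmul_eq_reducesToZero_of_cover O
    (M := show WeierstrassCurve O from W.localSpectralModel v) (p := 3) hcover
    ((W.mem_localKernelOfReduction_iff v a).mp ha)
  refine ⟨T.symm R, (W.mem_localKernelOfReduction_iff v _).mpr (by rw [AddEquiv.apply_symm_apply]; exact hR), ?_⟩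
  apply T.injective
  rw [map_nsmul, AddEquiv.apply_symm_apply]
  exact h3R

/-- **`×3 : Fil_v E[3^{k+1}] → Fil_v E[3^k]` is onto at a multiplicative `v ∋ 3`, GIVEN the level-one component clause (‡)** — the binder
`hFsurj` of x9's `ZpExtension.eisensteinTwistTransfer_mem_twistedFil` / the conclusion of `exists_mem_torsionFilAt_reduce_eq` (there: good
reduction + ordinary point), from the `3`-divisibility of `E₁(K̄_v)` above and the algebraicity of torsion (`exists_pointsMapOfEmb_eq_of_nsmul_eq_zero`).
[cite: GreenbergLNM1716, §2 p. 82] [cite: SilvermanAEC2009, Cor. III.6.4 and VII.2] -/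
theorem exists_mem_torsionFilAt_reduce_eq_of_componentClause_three
    (h3v : ((3 : ℕ) : 𝓞 K) ∈ v.asIdeal) (hmult : W.HasMultiplicativeReductionAt v)
    (hcomp : ∀ R₁ R₂ : localPoints W (v.adicCompletion K),
      HasNonsingularReduction (W.localSpectralModel v) (W.localPointsEquivSpectralModel v ((3 : ℕ) • R₁)) →
      HasNonsingularReduction (W.localSpectralModel v) (W.localPointsEquivSpectralModel v ((3 : ℕ) • R₂)) →
      ¬ HasNonsingularReduction (W.localSpectralModel v) (W.localPointsEquivSpectralModel v R₁) →
        ∃ j : ℕ, HasNonsingularReduction (W.localSpectralModel v) (W.localPointsEquivSpectralModel v (R₂ - j • R₁)))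
    (t : ∀ k, (W.torsionGaloisModule (((3 : ℕ) : ℤ) ^ (k + 1))).toContRepresentation →ⁱL
      (W.torsionGaloisModule (((3 : ℕ) : ℤ) ^ k)).toContRepresentation)
    (ht : ∀ k (P : geomTorsion W (((3 : ℕ) : ℤ) ^ (k + 1))), t k P = W.geomTorsionReduce 3 k P)
    (k : ℕ) (y : geomTorsion W (((3 : ℕ) : ℤ) ^ k)) (hy : y ∈ W.torsionFilAt v (((3 : ℕ) : ℤ) ^ k)) :
    ∃ y' ∈ W.torsionFilAt v (((3 : ℕ) : ℤ) ^ (k + 1)), t k y' = y := by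
  haveI hp : Fact (Nat.Prime 3) := ⟨Nat.prime_three⟩
  obtain ⟨b, hb, hpb⟩ := W.exists_nsmul_eq_of_mem_localKernelOfReduction_of_componentClause_three v h3v hmult hcomp
    ((W.mem_torsionFilAt_iff v _ y).mp hy)
  -- `b` is `3^{k+1}`-torsion, hence algebraic
  have hy0 : (((3 : ℕ) : ℤ) ^ k) • (y : geomPoints W) = 0 := (mem_geomTorsion_iff W _ _).mp y.2
  have hbtor : (3 ^ (k + 1)) • b = 0 := by
    rw [pow_succ, mul_nsmul', hpb, ← map_nsmul, ← natCast_zsmul, Nat.cast_pow, hy0, map_zero]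
  obtain ⟨P, hP, hPb⟩ := exists_pointsMapOfEmb_eq_of_nsmul_eq_zero W (closureEmb (K := K) (v.adicCompletion K))
    (pow_ne_zero (k + 1) hp.out.ne_zero) hbtor
  have hPmem : P ∈ geomTorsion W (((3 : ℕ) : ℤ) ^ (k + 1)) := by
    rw [mem_geomTorsion_iff, ← Nat.cast_pow, natCast_zsmul]; exact hP
  refine ⟨⟨P, hPmem⟩, (W.mem_torsionFilAt_iff v _ _).mpr (by rw [hPb]; exact hb), ?_⟩
  rw [ht]
  apply Subtype.ext
  rw [W.coe_geomTorsionReduce]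
  apply pointsMapOfEmb_injective W (closureEmb (K := K) (v.adicCompletion K))
  change pointsMapOfEmb W (closureEmb (K := K) (v.adicCompletion K)) (((3 : ℕ) : ℤ) • P) =
    pointsMapOfEmb W (closureEmb (K := K) (v.adicCompletion K)) (y : geomPoints W)
  rw [map_zsmul, hPb, ← hpb, natCast_zsmul]

end NumberField

end WeierstrassCurve

end
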